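import Literature.NumberTheory.Automorphic.UnitaryGroupIsotropicRootSymplectic
import Literature.NumberTheory.Automorphic.Liu2021.LemD1IsotropyOfPlace
import HarnessLib

/-!
# Quasi-reflections and the hyperbolic swap of a unitary group; root data of `U(J)(F_v)` at a finite place
# (an isotropic vector for `N ≥ 3`, a hyperbolic partner at a non-split place, the swap `r ↔ r'` through `ι_v`)

Topic `NumberTheory/Automorphic`; namespace `Literature.NumberTheory.Automorphic.UnitaryGroup` (sequel of
`UnitaryGroupIsotropicRootSymplectic`: `rootNilMatrix`, `conj_lineRoot_zero`, `localRootElt`, `localRootNil`).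
KERNEL ONLY: definitions with bodies and theorems; no named fact, no `sorry`.

* §1 (generic, over a commutative ring `S` with `σ`, `H`, `h = hermForm σ H`) the general QUASI-REFLECTION
  `v ↦ v + (a h(u, v)) • u` along ANY vector `u` as a unit `quasiReflGL σ H u a b` (inverse parameter `b`,
  `a + b + a b h(u,u) = 0`), an isometry when `a + σ a + σ(a) a h(u,u) = 0` ([Dieudonne1971GroupesClassiques, Chap. II §4]:
  «quasi-symétries» and «transvections unitaires»; the tree's `UnitaryGroupLocalReflections` treats `σ`-fixed `u`, B-p19's
  `lineRootGL` isotropic `u`), and the HYPERBOLIC SWAP `lineSwapGL σ H h2` of a pair `(r, r')` with `h(r − r', r − r') = −2`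
  (the quasi-reflection along `r − r'` with `a = b = 1`, an involution): `r ↦ r'`, `r' ↦ r`, identity on `{r, r'}^⊥`, in
  `U(σ, H)`, and `w₀ T_r(0, z) w₀⁻¹ = T_{r'}(0, z)`.
* §2 (at a finite place `v` of the quadratic extension `E/F`, Gram `J_v` of `UnitaryGroup.«local» E c N J v`, `σ = c ⊗ 1`)
  ROOT DATA: for `N ≥ 3` the hermitian space `(E_vᴺ, J_v)` has a non-zero isotropic vector at EVERY finite `v`
  (`exists_isotropic_localGram` — trace form over `F_v` in `2N ≥ 6` variables + `u(F_v) = 4`, the route of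
  `Liu2021/LemD1IsotropyOfPlace`, [Lam2005, Ch. VI Thm 2.12]); at a non-split `v` (`E_v` a field) every non-zero isotropic
  `r` has a hyperbolic partner (`exists_hyperbolic_partner_localGram`, B-p19's `exists_hyperbolic_partner_hermForm`); the swap
  `localSwapElt … h2 ∈ U(J)(F_v)` (factor form `localPi`) with `w₀⁻¹ = w₀`, **`w₀ n_{bδ}(r) w₀⁻¹ = n_{bδ}(r')`**
  (`localSwapElt_conj_localRootElt`) and its symplectic action `ι_v(w₀)(reIm u) = reIm (u + h(r − r', u) • (r − r'))`;
  and the geometry of the two root images in `𝕎_v` (input of the polarisation mover P4): `im 𝔫_r = Res(E_v r)`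
  (`range_localRootNil_eq_of_partner`), the DUALITY `A(𝔫_r x, 𝔫_{r'} y) = −d · im(σ(α) β)` (`α = h(r,u)`, `β = h(r',u')`;
  `alt_polar_localRootNil_localRootNil_partner`) and the orthogonality `A(𝔫_r x, Res w) = 0`, `𝔫_r (Res w) = 0` for `w ⊥ r`.
  Finally the two-line dictionary for `δ₂ = a δ₁` (`a ∈ Fˣ`): `n^{δ₂}_b(r) = n^{δ₁}_{ab}(r)` (`localRootElt_eq_localRootElt_mul`) and
  `ι_{δ₂}(n^{δ₁}_b(r)) x = x + (b/a) • 𝔫^{δ₂} x` (`iota_localRootElt_apply_of_eq_mul`).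

Written for the cell `hodgecm-mathlib` (fan B; row IV-4(c1) `rankOne_theta_lines_disjoint`, support form of the compact
doubling, piece P2 «root data through ι»: the opposite root elements `n̄_b = w₀ n_b w₀⁻¹`).  Nothing about theta lifts is
asserted here.

## References
* [Dieudonne1971GroupesClassiques] J. Dieudonné, *La géométrie des groupes classiques*, 3e éd. (1971), Chap. II §§4–5.
* [MoeglinVignerasWaldspurger1987] C. Mœglin, M.-F. Vignéras, J.-L. Waldspurger, LNM 1291 (1987), Chap. 1 I.17,
  Chap. 3 §IV.2.
* [Lam2005] T. Y. Lam, *Introduction to quadratic forms over fields*, GSM 67, Ch. VI Thm 2.12 (`u(F_v) = 4`).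
-/

set_option autoImplicit false

noncomputable section

open Matrix NumberField IsDedekindDomain
open Literature.RepresentationTheory.HeisenbergGroup
open Literature.NumberTheory.GelbartRogawski1991.UnitaryDualPair.LocalSplitting (iota localPairing)

namespace Literature.NumberTheory.Automorphic.UnitaryGroup

/-! ## §1 Generic: quasi-reflections along any vector and the hyperbolic swap -/

section Generic

variable {S : Type*} [CommRing S] (σ : S →+* S) {n : Type*} [Fintype n] [DecidableEq n] (H : Matrix n n S)

/-- **the quasi-reflection `v ↦ v + (a h(u, v)) • u` as a unit** of `Mₙ(S)`, with inverse `v ↦ v + (b h(u, v)) • u` where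
`a + b + a b h(u, u) = 0` (for `u` isotropic: `b = −a`; for the hyperbolic swap: `a = b = 1`, `h(u,u) = −2`).
[cite: Dieudonne1971GroupesClassiques, Chap. II §4] -/
def quasiReflGL (u : n → S) (a b : S) (hab : a + b + a * b * hermForm σ H u u = 0) : GL n S where
  val := lineRoot σ H u 0 a
  inv := lineRoot σ H u 0 b
  val_inv := by rw [lineRoot_zero_mul_lineRoot_zero, hab, lineRoot_zero_zero]
  inv_val := by
    rw [lineRoot_zero_mul_lineRoot_zero, show b + a + b * a * hermForm σ H u u = 0 by rw [← hab]; ring, lineRoot_zero_zero]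

/-- underlying matrix of `quasiReflGL`. [cite: Dieudonne1971GroupesClassiques, Chap. II §4] -/
@[simp] theorem coe_quasiReflGL (u : n → S) (a b : S) (hab : a + b + a * b * hermForm σ H u u = 0) :
    ((quasiReflGL σ H u a b hab : GL n S) : Matrix n n S) = lineRoot σ H u 0 a := rfl

/-- inverse matrix of `quasiReflGL`. [cite: Dieudonne1971GroupesClassiques, Chap. II §4] -/
@[simp] theorem coe_quasiReflGL_inv (u : n → S) (a b : S) (hab : a + b + a * b * hermForm σ H u u = 0) :
    (((quasiReflGL σ H u a b hab)⁻¹ : GL n S) : Matrix n n S) = lineRoot σ H u 0 b := rfl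

/-- **a quasi-reflection is an isometry**: `h(T v, T v') = h(v, v')` for `T v = v + (a h(u,v)) • u` whenever
`a + σ a + σ(a) a h(u, u) = 0` (`σ` an involution, `H` hermitian; `u` arbitrary). [cite: Dieudonne1971GroupesClassiques, Chap. II §4] -/
theorem lineRoot_zero_isometry (hσ : ∀ s, σ (σ s) = s) (hH : (H.map σ)ᵀ = H) (u : n → S) {a : S}
    (ha : a + σ a + σ a * a * hermForm σ H u u = 0) (v v' : n → S) :
    hermForm σ H (lineRoot σ H u 0 a *ᵥ v) (lineRoot σ H u 0 a *ᵥ v') = hermForm σ H v v' := by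
  have hvu : hermForm σ H v u = σ (hermForm σ H u v) := (conj_hermForm σ H hσ hH u v).symm
  rw [lineRoot_zero_mulVec, lineRoot_zero_mulVec]
  simp only [hermForm_add_left, hermForm_add_right, hermForm_smul_left_eq, hermForm_smul_right, map_mul, hvu]
  linear_combination (σ (hermForm σ H u v) * hermForm σ H u v') * ha

/-- **`quasiReflGL ∈ U(σ, H)`** under `a + σ a + σ(a) a h(u, u) = 0`. [cite: Dieudonne1971GroupesClassiques, Chap. II §4] -/
theorem quasiReflGL_mem (hσ : ∀ s, σ (σ s) = s) (hH : (H.map σ)ᵀ = H) (u : n → S) {a b : S}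
    (hab : a + b + a * b * hermForm σ H u u = 0) (ha : a + σ a + σ a * a * hermForm σ H u u = 0) :
    quasiReflGL σ H u a b hab ∈ unitaryGroupOfForm σ H := by
  rw [mem_unitaryGroupOfForm_iff_hermForm, coe_quasiReflGL]
  exact lineRoot_zero_isometry σ H hσ hH u ha

/-- for a hyperbolic pair `(r, r')` (`h(r,r) = h(r',r') = 0`, `h(r,r') = h(r',r) = 1`): `h(r − r', r − r') = −2`.
[cite: Dieudonne1971GroupesClassiques, Chap. II §5] -/
theorem hermForm_sub_sub_of_hyperbolic {r r' : n → S} (hr : hermForm σ H r r = 0) (hr' : hermForm σ H r' r' = 0)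
    (hrr' : hermForm σ H r r' = 1) (hr'r : hermForm σ H r' r = 1) : hermForm σ H (r - r') (r - r') = -2 := by
  rw [hermForm_sub_left, hermForm_sub_right, hermForm_sub_right, hr, hr', hrr', hr'r]; ring

/-- **the hyperbolic swap** `w₀ = 1 + (r − r') ⊗ h(r − r', ·)` of a pair `(r, r')` with `h(r − r', r − r') = −2`: the
quasi-reflection along `r − r'` with `a = b = 1` (an involution). [cite: Dieudonne1971GroupesClassiques, Chap. II §5] -/
def lineSwapGL {r r' : n → S} (h2 : hermForm σ H (r - r') (r - r') = -2) : GL n S :=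
  quasiReflGL σ H (r - r') 1 1 (by rw [h2]; ring)

/-- underlying matrix of the swap. [cite: Dieudonne1971GroupesClassiques, Chap. II §5] -/
@[simp] theorem coe_lineSwapGL {r r' : n → S} (h2 : hermForm σ H (r - r') (r - r') = -2) :
    ((lineSwapGL σ H h2 : GL n S) : Matrix n n S) = lineRoot σ H (r - r') 0 1 := rfl

/-- the swap is an involution: `w₀⁻¹ = w₀`. [cite: Dieudonne1971GroupesClassiques, Chap. II §5] -/
theorem lineSwapGL_inv {r r' : n → S} (h2 : hermForm σ H (r - r') (r - r') = -2) :
    (lineSwapGL σ H h2)⁻¹ = lineSwapGL σ H h2 := Units.ext rfl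

/-- action of the swap: `w₀ v = v + h(r − r', v) • (r − r')`. [cite: Dieudonne1971GroupesClassiques, Chap. II §5] -/
theorem lineSwapGL_mulVec {r r' : n → S} (h2 : hermForm σ H (r - r') (r - r') = -2) (v : n → S) :
    ((lineSwapGL σ H h2 : GL n S) : Matrix n n S) *ᵥ v = v + hermForm σ H (r - r') v • (r - r') := by
  rw [coe_lineSwapGL, lineRoot_zero_mulVec, one_mul]

/-- **`w₀ r = r'`**. [cite: Dieudonne1971GroupesClassiques, Chap. II §5] -/
theorem lineSwapGL_mulVec_left {r r' : n → S} (h2 : hermForm σ H (r - r') (r - r') = -2) (hr : hermForm σ H r r = 0)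
    (hr'r : hermForm σ H r' r = 1) : ((lineSwapGL σ H h2 : GL n S) : Matrix n n S) *ᵥ r = r' := by
  rw [lineSwapGL_mulVec, hermForm_sub_left, hr, hr'r]; module

/-- **`w₀ r' = r`**. [cite: Dieudonne1971GroupesClassiques, Chap. II §5] -/
theorem lineSwapGL_mulVec_right {r r' : n → S} (h2 : hermForm σ H (r - r') (r - r') = -2) (hrr' : hermForm σ H r r' = 1)
    (hr' : hermForm σ H r' r' = 0) : ((lineSwapGL σ H h2 : GL n S) : Matrix n n S) *ᵥ r' = r := by
  rw [lineSwapGL_mulVec, hermForm_sub_left, hrr', hr']; module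

/-- **`w₀ v = v` for `v ⊥ r, r'`**. [cite: Dieudonne1971GroupesClassiques, Chap. II §5] -/
theorem lineSwapGL_mulVec_of_orth {r r' : n → S} (h2 : hermForm σ H (r - r') (r - r') = -2) {v : n → S}
    (hrv : hermForm σ H r v = 0) (hr'v : hermForm σ H r' v = 0) : ((lineSwapGL σ H h2 : GL n S) : Matrix n n S) *ᵥ v = v := by
  rw [lineSwapGL_mulVec, hermForm_sub_left, hrv, hr'v, sub_zero, zero_smul, add_zero]

/-- **`w₀ ∈ U(σ, H)`** (`σ` an involution, `H` hermitian). [cite: Dieudonne1971GroupesClassiques, Chap. II §5] -/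
theorem lineSwapGL_mem (hσ : ∀ s, σ (σ s) = s) (hH : (H.map σ)ᵀ = H) {r r' : n → S}
    (h2 : hermForm σ H (r - r') (r - r') = -2) : lineSwapGL σ H h2 ∈ unitaryGroupOfForm σ H :=
  quasiReflGL_mem σ H hσ hH (r - r') _ (by rw [map_one, h2]; ring)

/-- **the swap conjugates the root elements of `r` to those of `r'`**: `w₀ T_r(0, z) w₀⁻¹ = T_{r'}(0, z)`.
[cite: Dieudonne1971GroupesClassiques, Chap. II §5] -/
theorem lineSwapGL_conj_lineRoot (hσ : ∀ s, σ (σ s) = s) (hH : (H.map σ)ᵀ = H) {r r' : n → S}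
    (h2 : hermForm σ H (r - r') (r - r') = -2) (hr : hermForm σ H r r = 0) (hr'r : hermForm σ H r' r = 1) (z : S) :
    ((lineSwapGL σ H h2 : GL n S) : Matrix n n S) * lineRoot σ H r 0 z * (((lineSwapGL σ H h2)⁻¹ : GL n S) : Matrix n n S) =
      lineRoot σ H r' 0 z := by
  rw [conj_lineRoot_zero σ H _ (lineSwapGL_mem σ H hσ hH h2), lineSwapGL_mulVec_left σ H h2 hr hr'r]


end Generic


/-! ## §2 Root data at a finite place: an isotropic vector (`N ≥ 3`), a hyperbolic partner (`E_v` a field), the swap -/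

section RootData

variable {F : Type} [Field F] [NumberField F] (E : Type) [Field E] [NumberField E] [Algebra F E]
  [Algebra.IsQuadraticExtension F E] (c : E ≃ₐ[F] E) (N : ℕ) (J : Matrix (Fin N) (Fin N) E)
  (v : HeightOneSpectrum (𝓞 F)) {δ : E} (hcδ : c δ = -δ) (hδ : δ ≠ 0)

include hcδ hδ in
/-- **for `N ≥ 3` the hermitian space `(E_vᴺ, J_v)` is isotropic at EVERY finite place `v`** (`J` hermitian, `det J ≠ 0`): the
trace form `x ↦ Tr_{E_v/F_v} h(x, x)` is an `F_v`-quadratic form in `2N ≥ 6` variables, hence has a non-trivial zero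
(`u(F_v) = 4`, tree `QuadraticForms.not_anisotropic_of_five_le_finrank_adicCompletion`), which is a zero of `h` — the
route of `Liu2021/LemD1IsotropyOfPlace`, read at the bare Gram matrix of `UnitaryGroup.«local» E c N J v`.
[cite: Lam2005, Ch. VI Thm 2.12] [cite: MoeglinVignerasWaldspurger1987, Chap. 1 I.1] -/
theorem exists_isotropic_localGram (hN : 3 ≤ N) (hJh : (J.map c)ᵀ = J) (hJdet : J.det ≠ 0) :
    ∃ r : Fin N → LocalRing E v, r ≠ 0 ∧ hermForm (conjLocal E c v) ((adelicForm E N J).map (adeleToLocal E v)) r r = 0 := by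
  have hN2 : 2 ≤ N := le_trans (by norm_num) hN
  obtain ⟨Q, hQ⟩ := (Liu2021.LemD1OfPlace.standingData E v c N J hcδ hδ hN2 hJh hJdet).exists_quadraticForm_trace_form
  have hnot : ¬ Q.Anisotropic := QuadraticForms.not_anisotropic_of_five_le_finrank_adicCompletion F v Q
    (Liu2021.LemD1OfPlace.five_le_finrank_pi_localRing E v hN)
  unfold QuadraticMap.Anisotropic at hnot
  push Not at hnot
  obtain ⟨x, hQx, hx0⟩ := hnot
  refine ⟨x, hx0, ?_⟩
  have h0 := Liu2021.LemD1OfPlace.form_self_eq_zero_of_trace_eq_zero E v c N J hcδ hδ hN2 hJh hJdet x (by rw [← hQ]; exact hQx)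
  exact h0

include hcδ hδ in
/-- **a hyperbolic partner at a non-split place**: `E_v` a field (`IsField`), `J` hermitian with `det J ≠ 0`, `r ≠ 0` isotropic
⟹ `∃ r', h(r', r') = 0 ∧ h(r, r') = 1` (B-p19's `exists_hyperbolic_partner_hermForm` over the field `E_v`).
[cite: Dieudonne1971GroupesClassiques, Chap. II §5] -/
theorem exists_hyperbolic_partner_localGram (hE : IsField (LocalRing E v)) (hJh : (J.map c)ᵀ = J) (hJdet : J.det ≠ 0)
    {r : Fin N → LocalRing E v} (hr : hermForm (conjLocal E c v) ((adelicForm E N J).map (adeleToLocal E v)) r r = 0)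
    (hr0 : r ≠ 0) :
    ∃ r' : Fin N → LocalRing E v, hermForm (conjLocal E c v) ((adelicForm E N J).map (adeleToLocal E v)) r' r' = 0 ∧
      hermForm (conjLocal E c v) ((adelicForm E N J).map (adeleToLocal E v)) r r' = 1 := by
  letI : Field (LocalRing E v) := hE.toField
  haveI : CharZero (v.adicCompletion F) := charZero_of_injective_algebraMap (algebraMap F (v.adicCompletion F)).injective
  have h2 : (2 : LocalRing E v) ≠ 0 := by
    rw [show (2 : LocalRing E v) = algebraMap (v.adicCompletion F) (LocalRing E v) 2 by rw [map_ofNat]]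
    exact (map_ne_zero (algebraMap (v.adicCompletion F) (LocalRing E v))).2 two_ne_zero
  exact exists_hyperbolic_partner_hermForm (conjLocal E c v) _ h2 (Liu2021.LemD1OfPlace.conjLocal_conjLocal_apply E v c hcδ hδ)
    (Liu2021.LemD1OfPlace.localGram_hermitian E v c N J hJh) (Liu2021.LemD1OfPlace.isUnit_det_localGram E v N J hJdet).ne_zero hr hr0

include hcδ hδ in
/-- `h(r', r) = 1` from `h(r, r') = 1` (`h` hermitian). [cite: Dieudonne1971GroupesClassiques, Chap. II §5] -/
theorem hermForm_localGram_partner_symm (hJh : (J.map c)ᵀ = J) {r r' : Fin N → LocalRing E v}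
    (hrr' : hermForm (conjLocal E c v) ((adelicForm E N J).map (adeleToLocal E v)) r r' = 1) :
    hermForm (conjLocal E c v) ((adelicForm E N J).map (adeleToLocal E v)) r' r = 1 := by
  rw [← conj_hermForm (conjLocal E c v) _ (Liu2021.LemD1OfPlace.conjLocal_conjLocal_apply E v c hcδ hδ)
    (Liu2021.LemD1OfPlace.localGram_hermitian E v c N J hJh) r r', hrr', map_one]

/-- **the hyperbolic swap `w₀ ∈ U(J)(F_v)`** (factor form `localPi`) of a pair `(r, r')` with `h(r − r', r − r') = −2`
(`hermForm_sub_sub_of_hyperbolic`): `r ↦ r'`, `r' ↦ r`, identity on `{r, r'}^⊥`. [cite: Dieudonne1971GroupesClassiques, Chap. II §5] -/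
def localSwapElt (hJh : (J.map c)ᵀ = J) {r r' : Fin N → LocalRing E v}
    (h2 : hermForm (conjLocal E c v) ((adelicForm E N J).map (adeleToLocal E v)) (r - r') (r - r') = -2) :
    localPi E c N J v :=
  (localPiEquiv E c N J v).symm
    ⟨lineSwapGL (conjLocal E c v) ((adelicForm E N J).map (adeleToLocal E v)) h2,
      lineSwapGL_mem _ _ (Liu2021.LemD1OfPlace.conjLocal_conjLocal_apply E v c hcδ hδ)
        (Liu2021.LemD1OfPlace.localGram_hermitian E v c N J hJh) h2⟩

/-- the matrix of `w₀` over `E_v`. [cite: Dieudonne1971GroupesClassiques, Chap. II §5] -/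
theorem coe_localPiEquiv_localSwapElt (hJh : (J.map c)ᵀ = J) {r r' : Fin N → LocalRing E v}
    (h2 : hermForm (conjLocal E c v) ((adelicForm E N J).map (adeleToLocal E v)) (r - r') (r - r') = -2) :
    ((localPiEquiv E c N J v (localSwapElt E c N J v hcδ hδ hJh h2) : «local» E c N J v) : GL (Fin N) (LocalRing E v)) =
      lineSwapGL (conjLocal E c v) ((adelicForm E N J).map (adeleToLocal E v)) h2 := by
  rw [localSwapElt, ContinuousMulEquiv.apply_symm_apply]

/-- `w₀⁻¹ = w₀`. [cite: Dieudonne1971GroupesClassiques, Chap. II §5] -/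
theorem localSwapElt_inv (hJh : (J.map c)ᵀ = J) {r r' : Fin N → LocalRing E v}
    (h2 : hermForm (conjLocal E c v) ((adelicForm E N J).map (adeleToLocal E v)) (r - r') (r - r') = -2) :
    (localSwapElt E c N J v hcδ hδ hJh h2)⁻¹ = localSwapElt E c N J v hcδ hδ hJh h2 := by
  apply (localPiEquiv E c N J v).injective
  rw [map_inv]
  apply Subtype.ext
  rw [Subgroup.coe_inv, coe_localPiEquiv_localSwapElt, lineSwapGL_inv]

/-- **`w₀ n_{bδ}(r) w₀⁻¹ = n_{bδ}(r')`**: the swap conjugates the root elements of `r` to those of its partner `r'`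
(`h(r,r) = h(r',r') = 0`, `h(r', r) = 1`). [cite: Dieudonne1971GroupesClassiques, Chap. II §5] -/
theorem localSwapElt_conj_localRootElt (hJh : (J.map c)ᵀ = J) {r r' : Fin N → LocalRing E v}
    (h2 : hermForm (conjLocal E c v) ((adelicForm E N J).map (adeleToLocal E v)) (r - r') (r - r') = -2)
    (hr : hermForm (conjLocal E c v) ((adelicForm E N J).map (adeleToLocal E v)) r r = 0)
    (hr' : hermForm (conjLocal E c v) ((adelicForm E N J).map (adeleToLocal E v)) r' r' = 0)
    (hr'r : hermForm (conjLocal E c v) ((adelicForm E N J).map (adeleToLocal E v)) r' r = 1) (b : v.adicCompletion F) :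
    localSwapElt E c N J v hcδ hδ hJh h2 * localRootElt E c N J v hcδ hδ hJh hr b * (localSwapElt E c N J v hcδ hδ hJh h2)⁻¹ =
      localRootElt E c N J v hcδ hδ hJh hr' b := by
  apply (localPiEquiv E c N J v).injective
  rw [map_mul, map_mul, map_inv]
  apply Subtype.ext
  apply Units.ext
  rw [Subgroup.coe_mul, Subgroup.coe_mul, Subgroup.coe_inv, Units.val_mul, Units.val_mul, coe_localPiEquiv_localSwapElt,
    coe_localPiEquiv_localRootElt, coe_localPiEquiv_localRootElt]
  exact lineSwapGL_conj_lineRoot _ _ (Liu2021.LemD1OfPlace.conjLocal_conjLocal_apply E v c hcδ hδ)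
    (Liu2021.LemD1OfPlace.localGram_hermitian E v c N J hJh) h2 hr hr'r _

variable {d : F} (hd : δ * δ = algebraMap F E d)

/-- **`ι_v(w₀) (reIm u) = reIm (u + h(r − r', u) • (r − r'))`**: the symplectic action of the swap.
[cite: MoeglinVignerasWaldspurger1987, Ch. 1 I.17] -/
theorem iota_localSwapElt_reIm (T : Matrix (Fin N) (Fin N) F) (hT : T.IsSymm)
    (hJ : J = T.map (algebraMap F E)) (hJh : (J.map c)ᵀ = J) {r r' : Fin N → LocalRing E v}
    (h2 : hermForm (conjLocal E c v) ((adelicForm E N J).map (adeleToLocal E v)) (r - r') (r - r') = -2)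
    (u : Fin N → LocalRing E v) :
    (iota F E c N hcδ hδ hd T hT hJ v (localSwapElt E c N J v hcδ hδ hJh h2)).1
        (QuadraticCoordinates.reIm (quadraticLocalEquiv E v c hcδ hδ).toLinearEquiv.toAddEquiv (Fin N) u) =
      QuadraticCoordinates.reIm (quadraticLocalEquiv E v c hcδ hδ).toLinearEquiv.toAddEquiv (Fin N)
        (u + hermForm (conjLocal E c v) ((adelicForm E N J).map (adeleToLocal E v)) (r - r') u • (r - r')) := by
  rw [localSwapElt, iota_localPiEquiv_symm_reIm]
  exact congrArg _ (lineSwapGL_mulVec _ _ h2 u)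

/-! ### The two root images in duality and the orthogonal complement (input of the polarisation mover) -/

/-- **`im 𝔫_r` and `im 𝔫_{r'}` are in duality**: `A(𝔫_r (reIm u), 𝔫_{r'} (reIm u')) = −d · im(σ(h(r,u)) · h(r',u'))` for a
pair with `h(r, r') = 1` (`h((δα) r, (δβ) r') = σ(δ) δ σ(α) β = −d σ(α) β`). [cite: MoeglinVignerasWaldspurger1987, Ch. 1 I.17] -/
theorem alt_polar_localRootNil_localRootNil_partner (T : Matrix (Fin N) (Fin N) F) (hT : T.IsSymm)
    (hJ : J = T.map (algebraMap F E)) {r r' : Fin N → LocalRing E v}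
    (hrr' : hermForm (conjLocal E c v) ((adelicForm E N J).map (adeleToLocal E v)) r r' = 1) (u u' : Fin N → LocalRing E v) :
    alt (polar (localPairing F N T v))
        (localRootNil E c N J v hcδ hδ hd r
          (QuadraticCoordinates.reIm (quadraticLocalEquiv E v c hcδ hδ).toLinearEquiv.toAddEquiv (Fin N) u))
        (localRootNil E c N J v hcδ hδ hd r'
          (QuadraticCoordinates.reIm (quadraticLocalEquiv E v c hcδ hδ).toLinearEquiv.toAddEquiv (Fin N) u')) =
      -(d : v.adicCompletion F) *
        QuadraticCoordinates.im (quadraticLocalEquiv E v c hcδ hδ).toLinearEquiv.toAddEquiv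
          (conjLocal E c v (hermForm (conjLocal E c v) ((adelicForm E N J).map (adeleToLocal E v)) r u) *
            hermForm (conjLocal E c v) ((adelicForm E N J).map (adeleToLocal E v)) r' u') := by
  have hq := isQuadraticCoordinates_local E v c hcδ hδ hd
  rw [localRootNil_reIm, localRootNil_reIm, alt_polar_localPairing_reIm E c hcδ hδ hd T hT v, ← localForm_eq_map E N v T hJ,
    hermForm_smul_left_eq, hermForm_smul_right, hrr', mul_one]
  have key : conjLocal E c v (algebraMap E (LocalRing E v) δ *
        hermForm (conjLocal E c v) ((adelicForm E N J).map (adeleToLocal E v)) r u) *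
      (algebraMap E (LocalRing E v) δ * hermForm (conjLocal E c v) ((adelicForm E N J).map (adeleToLocal E v)) r' u') =
      toLocalRing E v (-(d : v.adicCompletion F)) *
        (conjLocal E c v (hermForm (conjLocal E c v) ((adelicForm E N J).map (adeleToLocal E v)) r u) *
          hermForm (conjLocal E c v) ((adelicForm E N J).map (adeleToLocal E v)) r' u') := by
    rw [RingHom.map_mul, conjLocal_algebraMap, hcδ, map_neg, map_neg, ← hq.mul_self]
    ring
  rw [key, hq.im_map_mul]

/-- **`im 𝔫_r` is orthogonal to `Res({r}^⊥)`**: `A(𝔫_r (reIm u), reIm w) = 0` for `h(r, w) = 0`.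
[cite: MoeglinVignerasWaldspurger1987, Ch. 1 I.17] -/
theorem alt_polar_localRootNil_reIm_of_orth (T : Matrix (Fin N) (Fin N) F) (hT : T.IsSymm)
    (hJ : J = T.map (algebraMap F E)) {r w : Fin N → LocalRing E v}
    (hrw : hermForm (conjLocal E c v) ((adelicForm E N J).map (adeleToLocal E v)) r w = 0) (u : Fin N → LocalRing E v) :
    alt (polar (localPairing F N T v))
        (localRootNil E c N J v hcδ hδ hd r
          (QuadraticCoordinates.reIm (quadraticLocalEquiv E v c hcδ hδ).toLinearEquiv.toAddEquiv (Fin N) u))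
        (QuadraticCoordinates.reIm (quadraticLocalEquiv E v c hcδ hδ).toLinearEquiv.toAddEquiv (Fin N) w) = 0 := by
  rw [localRootNil_reIm, alt_polar_localPairing_reIm E c hcδ hδ hd T hT v, ← localForm_eq_map E N v T hJ, hermForm_smul_left_eq,
    hrw, mul_zero, map_zero]

/-- `𝔫_r` kills `Res({r}^⊥)`: `𝔫_r (reIm w) = 0` for `h(r, w) = 0`. [cite: MoeglinVignerasWaldspurger1987, Ch. 1 I.17] -/
theorem localRootNil_reIm_of_orth {r w : Fin N → LocalRing E v}
    (hrw : hermForm (conjLocal E c v) ((adelicForm E N J).map (adeleToLocal E v)) r w = 0) :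
    localRootNil E c N J v hcδ hδ hd r
        (QuadraticCoordinates.reIm (quadraticLocalEquiv E v c hcδ hδ).toLinearEquiv.toAddEquiv (Fin N) w) = 0 := by
  rw [localRootNil_reIm, hrw, mul_zero, zero_smul, map_zero]

include hδ in
/-- **`im 𝔫_r = Res(E_v r)`** along a partner (`h(r, r') = 1`): the range of `𝔫_r` is exactly the image under `reIm` of the line
`E_v r` (`δ ⊗ 1` is invertible in `E_v`). [cite: MoeglinVignerasWaldspurger1987, Ch. 1 I.17] -/
theorem range_localRootNil_eq_of_partner {r r' : Fin N → LocalRing E v}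
    (hrr' : hermForm (conjLocal E c v) ((adelicForm E N J).map (adeleToLocal E v)) r r' = 1) :
    Set.range (localRootNil E c N J v hcδ hδ hd r) =
      (QuadraticCoordinates.reIm (quadraticLocalEquiv E v c hcδ hδ).toLinearEquiv.toAddEquiv (Fin N)) ''
        Set.range (fun t : LocalRing E v => t • r) := by
  ext p
  constructor
  · rintro ⟨q, rfl⟩
    obtain ⟨u, rfl⟩ := (QuadraticCoordinates.reIm (quadraticLocalEquiv E v c hcδ hδ).toLinearEquiv.toAddEquiv (Fin N)).surjective q
    rw [localRootNil_reIm]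
    exact ⟨_, ⟨_, rfl⟩, rfl⟩
  · rintro ⟨_, ⟨t, rfl⟩, rfl⟩
    refine ⟨QuadraticCoordinates.reIm (quadraticLocalEquiv E v c hcδ hδ).toLinearEquiv.toAddEquiv (Fin N)
      ((algebraMap E (LocalRing E v) δ⁻¹ * t) • r'), ?_⟩
    rw [localRootNil_reIm_smul_partner E c N J v hcδ hδ hd hrr', ← mul_assoc, ← map_mul, mul_inv_cancel₀ hδ, map_one, one_mul]

/-! ### Two lines `δ₁`, `δ₂ = a δ₁`: the same root element in the two parametrisations -/

/-- **the root element depends on `(b, δ)` only through `z = φ(b) · δ`**: `n^{δ₁}_{b₁}(r) = n^{δ₂}_{b₂}(r)` whenever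
`φ(b₁) δ₁ = φ(b₂) δ₂` in `E_v` (two trace-zero `δ`'s parametrise the SAME one-parameter group `N_r ∩ Z(N_r)`).
[cite: Dieudonne1971GroupesClassiques, Chap. II §5] -/
theorem localRootElt_eq_of_mul_delta_eq {δ₁ δ₂ : E} (hcδ₁ : c δ₁ = -δ₁) (hδ₁ : δ₁ ≠ 0) (hcδ₂ : c δ₂ = -δ₂) (hδ₂ : δ₂ ≠ 0)
    (hJh : (J.map c)ᵀ = J) {r : Fin N → LocalRing E v}
    (hr : hermForm (conjLocal E c v) ((adelicForm E N J).map (adeleToLocal E v)) r r = 0) {b₁ b₂ : v.adicCompletion F}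
    (h : toLocalRing E v b₁ * algebraMap E (LocalRing E v) δ₁ = toLocalRing E v b₂ * algebraMap E (LocalRing E v) δ₂) :
    localRootElt E c N J v hcδ₁ hδ₁ hJh hr b₁ = localRootElt E c N J v hcδ₂ hδ₂ hJh hr b₂ := by
  apply (localPiEquiv E c N J v).injective
  apply Subtype.ext
  apply Units.ext
  rw [coe_localPiEquiv_localRootElt, coe_localPiEquiv_localRootElt, h]

omit [Algebra.IsQuadraticExtension F E] in
/-- `φ((a ⊗ 1) b) · δ₁ = φ(b) · δ₂` for `δ₂ = a δ₁`, `a ∈ F`. [cite: CasselsFrohlichANT1967, Ch. II §10] -/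
theorem toLocalRing_mul_delta_of_eq_mul {δ₁ δ₂ : E} {a : F} (ha : δ₂ = algebraMap F E a * δ₁) (b : v.adicCompletion F) :
    toLocalRing E v ((a : v.adicCompletion F) * b) * algebraMap E (LocalRing E v) δ₁ =
      toLocalRing E v b * algebraMap E (LocalRing E v) δ₂ := by
  rw [map_mul, toLocalRing_coe, ha, map_mul]; ring

/-- **two lines `δ₂ = a δ₁` (`a ∈ F`)**: `n^{δ₂}_b(r) = n^{δ₁}_{a b}(r)` — so through `ι_{δ₂}` the element `n^{δ₁}_b(r)` acts as
`x ↦ x + (b / a) • 𝔫^{δ₂} x` (`iota_localRootElt_apply` at `δ₂` with parameter `b / a`). [cite: Dieudonne1971GroupesClassiques, Chap. II §5] -/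
theorem localRootElt_eq_localRootElt_mul {δ₁ δ₂ : E} (hcδ₁ : c δ₁ = -δ₁) (hδ₁ : δ₁ ≠ 0) (hcδ₂ : c δ₂ = -δ₂) (hδ₂ : δ₂ ≠ 0)
    {a : F} (ha : δ₂ = algebraMap F E a * δ₁) (hJh : (J.map c)ᵀ = J) {r : Fin N → LocalRing E v}
    (hr : hermForm (conjLocal E c v) ((adelicForm E N J).map (adeleToLocal E v)) r r = 0) (b : v.adicCompletion F) :
    localRootElt E c N J v hcδ₂ hδ₂ hJh hr b = localRootElt E c N J v hcδ₁ hδ₁ hJh hr ((a : v.adicCompletion F) * b) :=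
  (localRootElt_eq_of_mul_delta_eq E c N J v hcδ₁ hδ₁ hcδ₂ hδ₂ hJh hr (toLocalRing_mul_delta_of_eq_mul E v ha b)).symm

/-- **through `ι_{δ₂}` the root element `n^{δ₁}_b(r)` is the unipotent `x ↦ x + (b / a) • 𝔫^{δ₂} x`** (`δ₂ = a δ₁`, `a ∈ Fˣ`) —
the shape in which the two embeddings `ι_{δ₁}`, `ι_{δ₂}` of the SAME one-parameter group enter the doubled model.
[cite: MoeglinVignerasWaldspurger1987, Ch. 1 I.17] -/
theorem iota_localRootElt_apply_of_eq_mul {δ₁ δ₂ : E} (hcδ₁ : c δ₁ = -δ₁) (hδ₁ : δ₁ ≠ 0) (hcδ₂ : c δ₂ = -δ₂) (hδ₂ : δ₂ ≠ 0)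
    {d₂ : F} (hd₂ : δ₂ * δ₂ = algebraMap F E d₂) {a : F} (ha : δ₂ = algebraMap F E a * δ₁)
    (T : Matrix (Fin N) (Fin N) F) (hT : T.IsSymm) (hJ : J = T.map (algebraMap F E)) (hJh : (J.map c)ᵀ = J)
    {r : Fin N → LocalRing E v} (hr : hermForm (conjLocal E c v) ((adelicForm E N J).map (adeleToLocal E v)) r r = 0)
    (b : v.adicCompletion F) (p : (Fin N → v.adicCompletion F) × (Fin N → v.adicCompletion F)) :
    (iota F E c N hcδ₂ hδ₂ hd₂ T hT hJ v (localRootElt E c N J v hcδ₁ hδ₁ hJh hr b)).1 p =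
      p + ((a : v.adicCompletion F)⁻¹ * b) • localRootNil E c N J v hcδ₂ hδ₂ hd₂ r p := by
  have ha0 : a ≠ 0 := by
    rintro rfl
    exact hδ₂ (by rw [ha, map_zero, zero_mul])
  have hK : (a : v.adicCompletion F) ≠ 0 := (map_ne_zero (algebraMap F (v.adicCompletion F))).2 ha0
  have hz : toLocalRing E v b * algebraMap E (LocalRing E v) δ₁ =
      toLocalRing E v ((a : v.adicCompletion F)⁻¹ * b) * algebraMap E (LocalRing E v) δ₂ := by
    rw [← toLocalRing_mul_delta_of_eq_mul E v ha, ← mul_assoc, mul_inv_cancel₀ hK, one_mul]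
  rw [localRootElt_eq_of_mul_delta_eq E c N J v hcδ₁ hδ₁ hcδ₂ hδ₂ hJh hr hz,
    iota_localRootElt_apply E c N J v hcδ₂ hδ₂ hd₂ T hT hJ hJh hr]

end RootData

end Literature.NumberTheory.Automorphic.UnitaryGroup

end
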